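import Summits.CriticalPhenomena.PercolationContinuityZ3.Theorems.PercNearOneGluingNoHeavyLowerTailSahiCTCLadderRowOneTFacts
import HarnessLib

/-!
# `NoHeavyLowerTail` (crux stmt-CriticalPhenomena-4575), P3 lane: the row `#dbl = 1` of the ladder `(L_t)` for every `t ≥ 2`

Support file (seat `prim-l12-p3`, gen 26; `--supports stmt-CriticalPhenomena-4575`).  Memo g26 §4.14.  With `n = τ − t + 1`, `P = cH(t,n)`,
`Q = cH(t−1,n)`, `R₁ = cH(t−1,n−1)` and `cH(t,n+1) = P + Q`, the three facts of `rowOneT_facts` pay the charge `(P+Q)·g + R₁·ε` of the row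
by the convex combination with weights `(n+1)·Y : G` of the plain and the pinned bound, `Y = n R₁ − t Q ≥ 0` (`cH_rowOne_signY`) and
`G = t(n+1−t)(P+Q) − n(n+1)R₁ > 0` (`cH_rowOne_signG`); the combination is an identity (`rowOneT_arith`).  Hence
**`coeff_ladder_rowOneT_nonneg`**: for `t`-live up-sets `𝒳, 𝒵`, every `t ≥ 2` and every profile `m` with one doubled point and
`τ ≥ 3t − 2` singly covered points, `[m] L_t ≥ 0` where `L_t = e_t·(Π·GF(𝒳∩𝒵) − GF 𝒳·GF 𝒵) − Θ_{t−1}·e_{≥t}·GF((𝒳∩𝒵)_t)`.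
Nothing is asserted about the crux.
-/

namespace Summit.CriticalPhenomena.PercolationContinuityZ3.Theorems.SahiCTCForms

open Finset MvPolynomial SahiCTCGenFun SahiCTCWeightedLYM

variable {α : Type*} [DecidableEq α] [Fintype α]

section RowOneTMain
variable {𝒳 𝒵 : Finset (Finset α)}

/-- `t · cH(t−1, n) ≤ n · cH(t−1, n−1)` for `t ≥ 2`, `n ≥ 2t − 1` (the pinned bound beats the charge on the `d`-sets). [this work] -/
theorem cH_rowOne_signY {t n : ℕ} (ht : 2 ≤ t) (hn : 2 * t ≤ n + 1) : t * cH (t - 1) n ≤ n * cH (t - 1) (n - 1) := by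
  obtain ⟨n', hn'⟩ : ∃ n', n = n' + 1 := ⟨n - 1, by omega⟩
  have hn1 : n - 1 = n' := by omega
  have e := cH_pascal (t - 1) n' (by omega) (by omega)
  have hmono := cH_mono_step (t - 1) n' (by omega) (by omega)
  rw [← hn'] at e
  rw [hn1, e]
  have h1 : t * cH (t - 1 - 1) n' ≤ (n' + 1 - (t - 1)) * cH (t - 1 - 1) n' := Nat.mul_le_mul_right _ (by omega)
  have h2 : t + (t - 1) ≤ n := by omega
  nlinarith [h1, hmono, h2, Nat.zero_le (cH (t - 1) n')]

/-- `(j+1)(n−j)·C(n+1,j+1) = n(n+1)·C(n−1,j)`. [folklore] -/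
theorem choose_shift_two_mul (n j : ℕ) (hn : 1 ≤ n) : (j + 1) * (n - j) * (n + 1).choose (j + 1) = n * (n + 1) * (n - 1).choose j := by
  obtain ⟨n', rfl⟩ : ∃ n', n = n' + 1 := ⟨n - 1, by omega⟩
  have h1 := Nat.add_one_mul_choose_eq (n' + 1) j      -- (n'+2) C(n'+1,j) = C(n'+2,j+1) (j+1)
  have h2 := Nat.add_one_mul_choose_eq n' j            -- (n'+1) C(n',j) = C(n'+1,j+1)(j+1)
  have h3 := Nat.choose_succ_right_eq (n' + 1) j       -- C(n'+1,j+1)(j+1) = C(n'+1,j)(n'+1-j)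
  rw [Nat.add_sub_cancel]
  have h4 : (n' + 1) * n'.choose j = (n' + 1).choose j * (n' + 1 - j) := by rw [h2, h3]
  calc (j + 1) * (n' + 1 - j) * (n' + 1 + 1).choose (j + 1)
      = ((n' + 1 + 1).choose (j + 1) * (j + 1)) * (n' + 1 - j) := by ring
    _ = (n' + 1 + 1) * (n' + 1).choose j * (n' + 1 - j) := by rw [← h1]
    _ = (n' + 1 + 1) * ((n' + 1).choose j * (n' + 1 - j)) := by ring
    _ = (n' + 1 + 1) * ((n' + 1) * n'.choose j) := by rw [h4]
    _ = (n' + 1) * (n' + 1 + 1) * n'.choose j := by ring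

/-- `n(n+1) · cH(t−1, n−1) < t(n+1−t) · cH(t, n+1)` for `t ≥ 2`, `n ≥ 2t − 1` (the plain bound beats the charge on the `T`-sets):
termwise `n(n+1)C(n−1,j) = (j+1)(n−j)C(n+1,j+1) ≤ t(n+1−t)C(n+1,j+1)` for `j ≤ t − 2`, plus the term `j = 0` of `cH(t, n+1)`. [this work] -/
theorem cH_rowOne_signG {t n : ℕ} (ht : 2 ≤ t) (hn : 2 * t ≤ n + 1) : n * (n + 1) * cH (t - 1) (n - 1) < t * (n + 1 - t) * cH t (n + 1) := by
  obtain ⟨t', ht'⟩ : ∃ t', t = t' + 1 := ⟨t - 1, by omega⟩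
  unfold cH
  rw [show min (t - 1) (n - 1 + 1 - (t - 1)) = t - 1 from by omega, show min t (n + 1 + 1 - t) = t from by omega,
    show t - 1 = t' from by omega, ht', sum_range_succ' (fun j => (n + 1).choose j), Nat.choose_zero_right]
  have hterm : ∀ j ∈ range t', n * (n + 1) * (n - 1).choose j ≤ (t' + 1) * (n + 1 - (t' + 1)) * (n + 1).choose (j + 1) := fun j hj => by
    have hj := mem_range.1 hj
    rw [← choose_shift_two_mul n j (by omega)]
    refine Nat.mul_le_mul_right _ ?_
    -- (j+1)(n-j) ≤ t(n+1-t):  t(n+1-t) - (j+1)(n-j) = (t-j-1)(n-t-j)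
    have hjt : j ≤ t' := by omega
    have h1 : (0 : ℤ) ≤ (t' : ℤ) - j := by
      have : ((j : ℕ) : ℤ) ≤ t' := by exact_mod_cast hjt
      linarith
    have h2 : (0 : ℤ) ≤ (n : ℤ) - t' - 1 - j := by
      have : ((j + t' + 2 : ℕ) : ℤ) ≤ ((n + 1 : ℕ) : ℤ) := by exact_mod_cast (show j + t' + 2 ≤ n + 1 by omega)
      push_cast at this; linarith
    zify [show j ≤ n by omega, show t' + 1 ≤ n + 1 by omega]
    nlinarith [mul_nonneg h1 h2]
  have hsum : n * (n + 1) * ∑ j ∈ range t', (n - 1).choose j ≤ (t' + 1) * (n + 1 - (t' + 1)) * ∑ k ∈ range t', (n + 1).choose (k + 1) := by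
    rw [mul_sum, mul_sum]; exact sum_le_sum hterm
  have hpos : 0 < (t' + 1) * (n + 1 - (t' + 1)) := by
    have : 1 ≤ n + 1 - (t' + 1) := by omega
    positivity
  linarith [hsum, hpos]

omit [DecidableEq α] [Fintype α] in
/-- The arithmetic of the row `#dbl = 1` of `(L_t)`: weights `(n+1)Y` (plain) and `G` (pinned), an identity. [this work] -/
theorem rowOneT_arith {n t P Q R₁ g ε g' ε' R L : ℤ} (hn : 0 < n) (ht : 0 < t)
    (NP : (P + Q) * (t * n * g + t * (n + 1 - t) * ε) ≤ n * (n + 1) * R) (NQ : n * P * g + t * Q * ε ≤ n * R) (NL : n * R₁ * g ≤ t * L)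
    (hY : t * Q ≤ n * R₁) (hG : n * (n + 1) * R₁ < t * (n + 1 - t) * (P + Q)) (hPQ : 0 ≤ P + Q) (hR₁ : 0 ≤ R₁)
    (hg : g' ≤ g) (hε : ε' ≤ ε) : (P + Q) * g' + R₁ * ε' ≤ R + L := by
  have hmono : (P + Q) * g' + R₁ * ε' ≤ (P + Q) * g + R₁ * ε := by
    nlinarith [mul_le_mul_of_nonneg_left hg hPQ, mul_le_mul_of_nonneg_left hε hR₁]
  refine hmono.trans ?_
  have hYn : 0 ≤ n * R₁ - t * Q := by linarith
  have hGp : 0 < t * (n + 1 - t) * (P + Q) - n * (n + 1) * R₁ := by linarith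
  have hM : 0 < (n + 1) * (n * R₁ - t * Q) + (t * (n + 1 - t) * (P + Q) - n * (n + 1) * R₁) := by nlinarith
  have hK : 0 < t * n * (n + 1) * ((n + 1) * (n * R₁ - t * Q) + (t * (n + 1 - t) * (P + Q) - n * (n + 1) * R₁)) := by positivity
  refine le_of_mul_le_mul_left ?_ hK
  have s1 : 0 ≤ t * (n + 1) * (n * R₁ - t * Q) * (n * (n + 1) * R - (P + Q) * (t * n * g + t * (n + 1 - t) * ε)) :=
    mul_nonneg (by positivity) (by linarith)
  have s2 : 0 ≤ t * (n + 1) * (t * (n + 1 - t) * (P + Q) - n * (n + 1) * R₁) * (n * R - (n * P * g + t * Q * ε)) :=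
    mul_nonneg (by positivity) (by linarith)
  have s3 : 0 ≤ n * (n + 1) * ((n + 1) * (n * R₁ - t * Q) + (t * (n + 1 - t) * (P + Q) - n * (n + 1) * R₁)) * (t * L - n * R₁ * g) :=
    mul_nonneg (by positivity) (by linarith)
  nlinarith [s1, s2, s3]

/-- **ROW `#dbl = 1` OF THE LADDER `(L_t)`, EVERY `t ≥ 2`**: for `t`-live up-sets `𝒳, 𝒵` and a profile `m` with exactly one doubled
point, all other exponents `≤ 2`, and `τ = #(lev m 1) ≥ 3t − 2`,
`0 ≤ [m] (e_t·(Π·GF(𝒳∩𝒵) − GF 𝒳·GF 𝒵) − Θ_{t−1}·e_{≥t}·GF((𝒳∩𝒵)_t))`. [this work] -/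
theorem coeff_ladder_rowOneT_nonneg (h𝒳 : IsUpperSet (𝒳 : Set (Finset α))) (h𝒵 : IsUpperSet (𝒵 : Set (Finset α)))
    {t : ℕ} (ht : 2 ≤ t) (hXt : ∀ S ∈ 𝒳, t ≤ #S) (hZt : ∀ S ∈ 𝒵, t ≤ #S) {m : α →₀ ℕ} (hm : ∀ i, m i ≤ 2) (hD : #(dbl m) = 1)
    (hτ : 3 * t - 2 ≤ #(lev m 1)) :
    0 ≤ (ee t * (PiP * gf (𝒳 ∩ 𝒵) - gf 𝒳 * gf 𝒵) -
      gf (bySize (· ≤ t - 1) : Finset (Finset α)) * gf (bySize (t ≤ ·) : Finset (Finset α)) *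
        gf ((𝒳 ∩ 𝒵).filter fun S => #S = t)).coeff m := by
  obtain ⟨d, hd⟩ : (dbl m).Nonempty := card_pos.1 (by omega)
  set W := (𝒳 ∩ 𝒵).filter fun S => #S = t with hWdef
  have hWt : ∀ w ∈ W, #w = t := fun w hw => (mem_filter.1 hw).2
  have hWsub : ∀ w ∈ W, w ∈ 𝒳 ∧ w ∈ 𝒵 := fun w hw => mem_inter.1 (mem_filter.1 hw).1
  rw [coeff_sub, sub_nonneg]
  refine (coeff_chargeT_rowOneT_le ht hm hD hd (by omega) W hWt).trans
    (le_trans ?_ (cubes_le_coeff_ee_mul_harris_rowOneT h𝒳 h𝒵 (by omega) hm hD hd))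
  have hg : #(((lev m 1).powersetCard (t - 1)).filter fun Q => insert d Q ∈ W) ≤
      #(((lev m 1).powersetCard (t - 1)).filter fun Q => insert d Q ∈ 𝒳 ∧ insert d Q ∈ 𝒵) :=
    card_le_card fun Q hQ => mem_filter.2 ⟨(mem_filter.1 hQ).1, hWsub _ (mem_filter.1 hQ).2⟩
  have hε : #(((lev m 1).powersetCard t).filter fun E => E ∈ W) ≤ #(((lev m 1).powersetCard t).filter fun E => E ∈ 𝒳 ∧ E ∈ 𝒵) :=
    card_le_card fun E hE => mem_filter.2 ⟨(mem_filter.1 hE).1, hWsub _ (mem_filter.1 hE).2⟩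
  obtain ⟨n, hn⟩ : ∃ n : ℕ, #(lev m 1) = n + (t - 1) := ⟨#(lev m 1) - (t - 1), by omega⟩
  have hnt : 2 * t ≤ n + 1 := by omega
  obtain ⟨NP, NQ, NL⟩ := rowOneT_facts h𝒳 h𝒵 ht hXt hZt hd hn hnt (𝒳 := 𝒳) (𝒵 := 𝒵)
  have hY := cH_rowOne_signY ht hnt
  have hG := cH_rowOne_signG ht hnt
  have hA : cH t (#(lev m 1) - t + 2) = cH t n + cH (t - 1) n := by
    rw [hn, show n + (t - 1) - t + 2 = n + 1 from by omega]; exact cH_pascal t n (by omega) (by omega)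
  have hR : cH (t - 1) (#(lev m 1) - t) = cH (t - 1) (n - 1) := by rw [hn, show n + (t - 1) - t = n - 1 from by omega]
  rw [hA, hR]; push_cast
  have hA' : (cH t (n + 1) : ℤ) = cH t n + cH (t - 1) n := by exact_mod_cast cH_pascal t n (by omega) (by omega)
  rw [hA'] at NP
  have hY' : (t : ℤ) * (cH (t - 1) n : ℤ) ≤ (n : ℤ) * (cH (t - 1) (n - 1) : ℤ) := by exact_mod_cast hY
  have hG' : (n : ℤ) * (n + 1) * (cH (t - 1) (n - 1) : ℤ) < (t : ℤ) * (n + 1 - t) * ((cH t n : ℤ) + cH (t - 1) n) := by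
    have h2 := hG; zify [show t ≤ n + 1 by omega] at h2; rw [hA'] at h2; linarith
  have hg' : (#(((lev m 1).powersetCard (t - 1)).filter fun Q => insert d Q ∈ W) : ℤ) ≤
      #(((lev m 1).powersetCard (t - 1)).filter fun Q => insert d Q ∈ 𝒳 ∧ insert d Q ∈ 𝒵) := by exact_mod_cast hg
  have hε' : (#(((lev m 1).powersetCard t).filter fun E => E ∈ W) : ℤ) ≤ #(((lev m 1).powersetCard t).filter fun E => E ∈ 𝒳 ∧ E ∈ 𝒵) := by
    exact_mod_cast hε
  have hfin := rowOneT_arith (by exact_mod_cast (show 0 < n by omega)) (by exact_mod_cast (show 0 < t by omega)) NP NQ NL hY' hG'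
    (by positivity) (Nat.cast_nonneg _) hg' hε'
  linarith only [hfin]

end RowOneTMain

end Summit.CriticalPhenomena.PercolationContinuityZ3.Theorems.SahiCTCForms
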